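import Literature.Analysis.FluidPDE.TaoH1FourierMildClassical
import Literature.Analysis.FunctionSpaces.FourierSobolevNormTemperedProofs
import HarnessLib

/-!
# The gradient part of a forcing term on the Fourier side: Leray projection of the force and
# Tao's normalised force pressure `Δ⁻¹ ∇·f`

Analysis/FluidPDE file of the FORCED twin of the tree's Fourier-side local existence engine for
the Navier–Stokes system (T. Tao, *Localisation and compactness properties of the Navier–Stokes
global regularity problem*, Anal. PDE 6 (2013) 25–107 = arXiv:1108.1165, Thm. 5.4 = arXiv Thm. 31
WITH forcing; target facts `tao2011_smooth_local_existence_forced` (`TaoH1LocalExistenceForced`)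
and `tao2011_forced_H1_local_almost_regular` (`TaoH1AlmostRegularForced`)). The engine is cut in
three: the EXISTENCE half (`ForcedFourierDuhamelDefs`, …: the Picard iteration for
`∂ₜv = -c‖ξ‖² v − N(v, v) + b` with DIVERGENCE-FREE force coefficients `b`), the PHYSICAL TRANSFER
(`ForcedFourierForceData`: the raw Fourier force `g(t) = 𝓕⁻¹ f(t)` of a Schwartz-on-slab force
`f`, with `synthVel (g t) = f t`), and the CLASSICAL half (synthesis of the mild solution for a
divergence-free `b`). This file supplies the missing **gauge of a raw force**: Tao's `H¹` mild
solution carries the *projected* force `P f` in the velocity equation and the *normalised pressure*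

  `p = -Δ⁻¹ ∂ᵢ∂ⱼ(uᵢ uⱼ) + Δ⁻¹ ∇·f`        (arXiv:1108.1165, (8), p. 3),

so that `-∇p + f = -∇(-Δ⁻¹∂ᵢ∂ⱼ(uᵢuⱼ)) + P f`. On the Fourier side (`∂ₗ ↔ -2πi ξₗ`, the tree's
dictionary `fderiv_fourier_apply_of_integrable`):

* §1 the frequency-wise **Leray projection** `lerayPart g ξ = g(ξ) − ξ (ξ·g(ξ))/‖ξ‖²` (the tree's
  `FourierNS.lerayPart`, `TaoH1FourierMild`) of a raw force and of its time-derivative tower keeps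
  every polynomial decay (`hasDecay_lerayPart`: constant `(1 + card ι) B`), measurability,
  continuity in time and the family structures `IsFourierFamily` / `IsDomFamily`
  (`isFourierFamily_lerayPart`, `isDomFamily_lerayPart`); it is divergence free
  (`sum_mul_lerayPart`, tree) and conjugation symmetric (`lerayPart_neg`, tree) — these are the
  force coefficients `b` consumed by `FourierNS.IsSobolevMildForced c T a b v`;
* §2 the **force-pressure symbol** `forcePresSymbol g ξ = i (ξ·g(ξ)) / (2π‖ξ‖²)`, the transform of
  `Δ⁻¹∇·f` (one `def`), with the LETTER IDENTITY
  `(-2πi ξₗ) · forcePresSymbol g ξ = g(ξ)ₗ − lerayPart g ξ ₗ` (`letter_mul_forcePresSymbol`: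
  `∇Δ⁻¹∇·f = f − P f` frequency-wise), conjugation symmetry, and the pointwise bound
  `‖forcePresSymbol g ξ‖ ≤ (card ι / 2π) ‖ξ‖⁻¹ ‖g ξ‖` — NOT a `HasDecay` bound: the symbol is
  unbounded at `ξ = 0` (the force pressure decays only like `|x|⁻²`);
* §3 (`ℝ³`) the **singular weight** `‖ξ‖⁻¹ (1 + ‖ξ‖)^{-K}` is in `L¹ ∩ L²(ℝ³)` (`1, 2 < 3`; the tree's
  `HomSobolev.integrable_norm_rpow_neg_mul_one_add_norm_rpow_neg`), whence integrable moments of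
  every order and square-integrable envelopes of the force-pressure symbol of a decaying force;
* §4 (`ℝ³`) the force-pressure tower of a force tower is a square-dominated family
  (`isDomFamily_forcePresSymbol`), so the force pressure `p_f(t) = Re 𝓕 forcePresSymbol (g t)` is
  JOINTLY SMOOTH on the closed slab (`isSmoothSpaceTimeOn_forcePressure`, by the tree's
  `contDiffOn_synth_infty_dom`);
* §5 (`ℝ³`) `∇p_f(t) = synthVel (g t) − synthVel (lerayPart (g t))`, i.e. `∇Δ⁻¹∇·f = f − P f`
  (`gradient_forcePressure`), and the Sobolev bounds `∫ ‖Dⁿ p_f(t)‖² ≤ C_n` for every `n ≥ 0`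
  (`n = 0`: `Δ⁻¹∇·f(t) ∈ L²(ℝ³)`, the term Tao's "`p ∈ L^∞_t H^k_x`, `k ≥ 0`" carries);
* §6 **re-gauging** a classical solution: a classical solution with force `f₁` and pressure `p₁`
  is a classical solution with force `f₂` and pressure `p₁ + p₂` whenever `∇p₂ = f₂ − f₁` and `p₂`
  is jointly smooth (`IsClassicalNSSolutionOn.add_gradient`), with the pressure Sobolev bounds of
  the sum; specialised to `f₁ = synthVel ∘ lerayPart ∘ g`, `f₂ = synthVel ∘ g`, `p₂ = p_f`
  (`IsClassicalNSSolutionOn.of_lerayPart_force`): the adapter from the classical half's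
  PROJECTED-force conclusion to the RAW force of `tao2011_smooth_local_existence_forced`.

One plumbing definition (`forcePresSymbol`); no named facts; nothing about Navier–Stokes
regularity or blow-up is asserted.

## Mathlib / tree search

Tree (`lean search`): `FourierNS.lerayPart`, `sum_mul_lerayPart`, `lerayPart_neg`,
`lerayPart_eq_self` (`TaoH1FourierMild`); `HasDecay` and its algebra (`NSFourierBilinear`,
`NSFourierFamily`); `IsFourierFamily` / `IsDomFamily` with `symbol`, `finset_sum`, `sub`
(`NSFourierFamily`, `NSRegFourierFamily`); `contDiffOn_synth_infty_dom` (`NSRegFourierSynthesis`);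
`fderiv_fourier_apply_of_integrable` (`TaoH1FourierMildSolution`); `lintegral_sq_fourier_eq`
(`NSLocalRegular`); `HomSobolev.integrable_norm_rpow_neg_mul_one_add_norm_rpow_neg`
(`FourierSobolevNormTemperedProofs`); `IsSmoothSpaceTimeOn.contDiff_slice`, `.add`
(`ClassicalSolution*`). No Fourier-side force pressure existed
(`lean search 'forcePres|Δ⁻¹ ∇·f|forcePotential'`: only the physical-side `forcePotential` of
`ForcePotentialRepresentation.lean`, Tao's `Δ⁻¹∇·f` as a Newtonian potential). Mathlib:
`Real.differentiable_fourier`, `Real.fderiv_fourier`, `Real.contDiff_fourier`, `PiLp.norm_apply_le`.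

## References

* T. Tao, Anal. PDE 6 (2013) 25–107 = arXiv:1108.1165: (7)–(8) p. 3 (Duhamel formula with
  force, normalised pressure `p = -Δ⁻¹∂ᵢ∂ⱼ(uᵢuⱼ) + Δ⁻¹∇·f`), `H¹` mild solutions p. 6, Thm. 5.4
  = arXiv Thm. 31 (p. 18) (iv): "`∂ₜʲ u, ∂ₜʲ p ∈ L^∞_t H^k([0, T] × ℝ³)` for all `j, k ≥ 0`".
  [Tao2011]
* P. G. Lemarié-Rieusset, *The Navier–Stokes Problem in the 21st Century*, CRC 2016, §6.1 (the
  Leray projection `P = Id − ∇Δ⁻¹ div` and its symbol `δⱼₖ − ξⱼξₖ/|ξ|²`). [LemarieRieusset2016]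
-/

noncomputable section

open MeasureTheory Real Set Filter Function Complex FourierTransform InnerProductSpace
open scoped FourierTransform RealInnerProductSpace ENNReal NNReal ContDiff ComplexConjugate
open _root_.Topology

namespace Literature.Analysis.FluidPDE

namespace FourierNS

variable {ι : Type*} [Fintype ι]

/-! ## §1 The Leray projection of a raw force -/

section Leray

/-- The bounded symbol `ξₗ ξₖ / ‖ξ‖²` of the Leray projection has norm at most `1`
(value `0` at `ξ = 0`). [folklore] -/
private theorem norm_lerayCoeff_le_one (ξ : EuclideanSpace ℝ ι) (l k : ι) :
    ‖((ξ l : ℝ) : ℂ) * ((ξ k : ℝ) : ℂ) / ((‖ξ‖ ^ 2 : ℝ) : ℂ)‖ ≤ 1 := by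
  by_cases hξ : ξ = 0
  · subst hξ; simp
  · have hn : 0 < ‖ξ‖ := norm_pos_iff.2 hξ
    rw [norm_div, norm_mul, Complex.norm_real, Complex.norm_real, Complex.norm_real,
      Real.norm_of_nonneg (pow_nonneg (norm_nonneg ξ) 2), div_le_one (pow_pos hn 2)]
    have h1 : ‖ξ l‖ ≤ ‖ξ‖ := PiLp.norm_apply_le ξ l
    have h2 : ‖ξ k‖ ≤ ‖ξ‖ := PiLp.norm_apply_le ξ k
    calc ‖ξ l‖ * ‖ξ k‖ ≤ ‖ξ‖ * ‖ξ‖ := mul_le_mul h1 h2 (norm_nonneg _) (norm_nonneg _)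
      _ = ‖ξ‖ ^ 2 := (sq _).symm

/-- The Leray symbol is measurable. [folklore] -/
private theorem measurable_lerayCoeff (l k : ι) :
    Measurable fun ξ : EuclideanSpace ℝ ι => ((ξ l : ℝ) : ℂ) * ((ξ k : ℝ) : ℂ) / ((‖ξ‖ ^ 2 : ℝ) : ℂ) := by
  have h1 : Continuous fun ξ : EuclideanSpace ℝ ι => ((ξ l : ℝ) : ℂ) := by fun_prop
  have h2 : Continuous fun ξ : EuclideanSpace ℝ ι => ((ξ k : ℝ) : ℂ) := by fun_prop
  have h3 : Continuous fun ξ : EuclideanSpace ℝ ι => ((‖ξ‖ ^ 2 : ℝ) : ℂ) := by fun_prop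
  exact (h1.measurable.mul h2.measurable).div h3.measurable

/-- The Leray part as "identity minus a sum of bounded symbols":
`lerayPart g ξ l = g ξ l − ∑ₖ (ξₗ ξₖ/‖ξ‖²) g ξ k`. [cite: LemarieRieusset2016, §6.1] -/
theorem lerayPart_eq_sub_sum (g : EuclideanSpace ℝ ι → ι → ℂ) (ξ : EuclideanSpace ℝ ι) (l : ι) :
    lerayPart g ξ l =
      g ξ l - ∑ k, ((ξ l : ℝ) : ℂ) * ((ξ k : ℝ) : ℂ) / ((‖ξ‖ ^ 2 : ℝ) : ℂ) * g ξ k := by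
  rw [lerayPart, Finset.mul_sum, Finset.sum_div]
  congr 1
  refine Finset.sum_congr rfl fun k _ => ?_
  ring

/-- **Pointwise bound of the Leray part**: `‖lerayPart g ξ l‖ ≤ (1 + card ι) ‖g ξ‖` (the Leray
symbol is bounded). [cite: LemarieRieusset2016, §6.1] -/
theorem norm_lerayPart_apply_le (g : EuclideanSpace ℝ ι → ι → ℂ) (ξ : EuclideanSpace ℝ ι) (l : ι) :
    ‖lerayPart g ξ l‖ ≤ (1 + Fintype.card ι) * ‖g ξ‖ := by
  rw [lerayPart_eq_sub_sum]
  have h1 : ‖g ξ l‖ ≤ ‖g ξ‖ := norm_le_pi_norm (g ξ) l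
  have h2 : ‖∑ k, ((ξ l : ℝ) : ℂ) * ((ξ k : ℝ) : ℂ) / ((‖ξ‖ ^ 2 : ℝ) : ℂ) * g ξ k‖ ≤
      Fintype.card ι * ‖g ξ‖ := by
    calc ‖∑ k, ((ξ l : ℝ) : ℂ) * ((ξ k : ℝ) : ℂ) / ((‖ξ‖ ^ 2 : ℝ) : ℂ) * g ξ k‖
        ≤ ∑ k, ‖((ξ l : ℝ) : ℂ) * ((ξ k : ℝ) : ℂ) / ((‖ξ‖ ^ 2 : ℝ) : ℂ) * g ξ k‖ :=
          norm_sum_le _ _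
      _ ≤ ∑ _k : ι, ‖g ξ‖ := Finset.sum_le_sum fun k _ => by
          rw [norm_mul]
          calc _ ≤ 1 * ‖g ξ k‖ :=
                mul_le_mul_of_nonneg_right (norm_lerayCoeff_le_one ξ l k) (norm_nonneg _)
            _ ≤ ‖g ξ‖ := by rw [one_mul]; exact norm_le_pi_norm (g ξ) k
      _ = Fintype.card ι * ‖g ξ‖ := by rw [Finset.sum_const, Finset.card_univ, nsmul_eq_mul]
  calc _ ≤ ‖g ξ l‖ + ‖∑ k, ((ξ l : ℝ) : ℂ) * ((ξ k : ℝ) : ℂ) / ((‖ξ‖ ^ 2 : ℝ) : ℂ) * g ξ k‖ :=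
        norm_sub_le _ _
    _ ≤ ‖g ξ‖ + Fintype.card ι * ‖g ξ‖ := add_le_add h1 h2
    _ = (1 + Fintype.card ι) * ‖g ξ‖ := by ring

/-- The Leray part as a vector: `‖lerayPart g ξ‖ ≤ (1 + card ι) ‖g ξ‖`. [cite: LemarieRieusset2016, §6.1] -/
theorem norm_lerayPart_le (g : EuclideanSpace ℝ ι → ι → ℂ) (ξ : EuclideanSpace ℝ ι) :
    ‖lerayPart g ξ‖ ≤ (1 + Fintype.card ι) * ‖g ξ‖ :=
  (pi_norm_le_iff_of_nonneg (by positivity)).2 fun l => norm_lerayPart_apply_le g ξ l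

/-- **The Leray projection keeps every polynomial decay** (constant `(1 + card ι) B`): the force
coefficients `b = lerayPart ∘ g` of the forced Picard scheme decay like the raw force
(Lemarié-Rieusset 2016, §6.1: `P` is a Fourier multiplier with bounded symbol).
[cite: LemarieRieusset2016, §6.1] -/
theorem hasDecay_lerayPart {K : ℕ} {B : ℝ} {g : EuclideanSpace ℝ ι → ι → ℂ} (hg : HasDecay K B g) :
    HasDecay K ((1 + Fintype.card ι) * B) (lerayPart g) :=
  hg.of_norm_le_mul (by positivity) (norm_lerayPart_le g)

/-- Measurability of a component of the Leray part from measurability of the components. [cite: LemarieRieusset2016, §6.1] -/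
theorem aestronglyMeasurable_lerayPart_apply {g : EuclideanSpace ℝ ι → ι → ℂ}
    (hg : ∀ k, AEStronglyMeasurable (fun ξ => g ξ k) volume) (l : ι) :
    AEStronglyMeasurable (fun ξ => lerayPart g ξ l) volume := by
  classical
  have h : (fun ξ => lerayPart g ξ l) = fun ξ =>
      g ξ l - ∑ k, ((ξ l : ℝ) : ℂ) * ((ξ k : ℝ) : ℂ) / ((‖ξ‖ ^ 2 : ℝ) : ℂ) * g ξ k :=
    funext fun ξ => lerayPart_eq_sub_sum g ξ l
  rw [h]
  exact (hg l).sub (Finset.aestronglyMeasurable_fun_sum _ fun k _ =>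
    (show AEStronglyMeasurable
        (fun ξ => ((ξ l : ℝ) : ℂ) * ((ξ k : ℝ) : ℂ) / ((‖ξ‖ ^ 2 : ℝ) : ℂ) * g ξ k) volume from
      (measurable_lerayCoeff l k).aestronglyMeasurable.mul (hg k)))

/-- **Joint measurability of the Leray part of a time-dependent force**: if `(t, ξ) ↦ g t ξ` is
jointly measurable then so is `(t, ξ) ↦ lerayPart (g t) ξ` (the projected force coefficients
`b = lerayPart ∘ g` are jointly Borel although NOT jointly continuous at `ξ = 0` unless the force
has zero spatial mean). [cite: LemarieRieusset2016, §6.1] -/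
theorem measurable_uncurry_lerayPart {g : ℝ → EuclideanSpace ℝ ι → ι → ℂ}
    (hg : Measurable (uncurry g)) :
    Measurable (uncurry fun t ξ => lerayPart (g t) ξ) := by
  refine measurable_pi_iff.2 fun l => ?_
  have h : (fun p : ℝ × EuclideanSpace ℝ ι => (uncurry fun t ξ => lerayPart (g t) ξ) p l) =
      fun p => uncurry g p l -
        ∑ k, ((p.2 l : ℝ) : ℂ) * ((p.2 k : ℝ) : ℂ) / ((‖p.2‖ ^ 2 : ℝ) : ℂ) * uncurry g p k := by
    funext p
    obtain ⟨t, ξ⟩ := p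
    exact lerayPart_eq_sub_sum (g t) ξ l
  rw [h]
  exact ((measurable_pi_apply l).comp hg).sub (Finset.measurable_sum _ fun k _ =>
    ((measurable_lerayCoeff l k).comp measurable_snd).mul ((measurable_pi_apply k).comp hg))

/-- Slice measurability of the Leray part of a time-dependent force with measurable slices. [cite: LemarieRieusset2016, §6.1] -/
theorem measurable_lerayPart_slice {g : ℝ → EuclideanSpace ℝ ι → ι → ℂ} (hg : ∀ t, Measurable (g t))
    (t : ℝ) : Measurable (fun ξ => lerayPart (g t) ξ) := by
  refine measurable_pi_iff.2 fun l => ?_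
  have h : (fun ξ => lerayPart (g t) ξ l) = fun ξ =>
      g t ξ l - ∑ k, ((ξ l : ℝ) : ℂ) * ((ξ k : ℝ) : ℂ) / ((‖ξ‖ ^ 2 : ℝ) : ℂ) * g t ξ k :=
    funext fun ξ => lerayPart_eq_sub_sum (g t) ξ l
  rw [h]
  exact ((measurable_pi_apply l).comp (hg t)).sub (Finset.measurable_sum _ fun k _ =>
    (measurable_lerayCoeff l k).mul ((measurable_pi_apply k).comp (hg t)))

/-- Continuity in time of the Leray part of a time-dependent force, at a fixed frequency. [cite: LemarieRieusset2016, §6.1] -/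
theorem continuous_lerayPart_time {g : ℝ → EuclideanSpace ℝ ι → ι → ℂ} {ξ : EuclideanSpace ℝ ι}
    (hg : ∀ k, Continuous fun t => g t ξ k) (l : ι) :
    Continuous fun t => lerayPart (g t) ξ l := by
  have h : (fun t => lerayPart (g t) ξ l) = fun t =>
      g t ξ l - ∑ k, ((ξ l : ℝ) : ℂ) * ((ξ k : ℝ) : ℂ) / ((‖ξ‖ ^ 2 : ℝ) : ℂ) * g t ξ k :=
    funext fun t => lerayPart_eq_sub_sum (g t) ξ l
  rw [h]
  exact (hg l).sub (continuous_finsetSum _ fun k _ => continuous_const.mul (hg k))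

/-- Continuity in time of the Leray part (vector form), at a fixed frequency. [cite: LemarieRieusset2016, §6.1] -/
theorem continuous_lerayPart_time' {g : ℝ → EuclideanSpace ℝ ι → ι → ℂ} {ξ : EuclideanSpace ℝ ι}
    (hg : Continuous fun t => g t ξ) : Continuous fun t => lerayPart (g t) ξ :=
  continuous_pi fun l => continuous_lerayPart_time
    (fun k => (continuous_apply k).comp hg) l

/-- Continuity in time on `[0, T]` of the Leray part, at a fixed frequency. [cite: LemarieRieusset2016, §6.1] -/
theorem continuousOn_lerayPart_time {T : ℝ} {g : ℝ → EuclideanSpace ℝ ι → ι → ℂ}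
    {ξ : EuclideanSpace ℝ ι} (hg : ∀ k, ContinuousOn (fun t => g t ξ k) (Icc 0 T)) (l : ι) :
    ContinuousOn (fun t => lerayPart (g t) ξ l) (Icc 0 T) := by
  have h : (fun t => lerayPart (g t) ξ l) = fun t =>
      g t ξ l - ∑ k, ((ξ l : ℝ) : ℂ) * ((ξ k : ℝ) : ℂ) / ((‖ξ‖ ^ 2 : ℝ) : ℂ) * g t ξ k :=
    funext fun t => lerayPart_eq_sub_sum (g t) ξ l
  rw [h]
  exact (hg l).sub (continuousOn_finsetSum _ fun k _ => continuousOn_const.mul (hg k))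

/-- **The Leray projection of a pointwise-decaying force tower is a pointwise-decaying tower**:
if every component of `G₀, …, G_n` is an `IsFourierFamily` on `[0, T]`, so is every component of
`lerayPart (G_k t)` (bounded measurable time-independent symbols; Lemarié-Rieusset 2016, §6.1).
[cite: LemarieRieusset2016, §6.1] -/
theorem isFourierFamily_lerayPart {T : ℝ} {n : ℕ} {G : ℕ → ℝ → EuclideanSpace ℝ ι → ι → ℂ}
    (hG : ∀ l, IsFourierFamily T n (fun k t ξ => G k t ξ l)) (l : ι) :
    IsFourierFamily T n (fun k t ξ => lerayPart (G k t) ξ l) := by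
  have hsum : IsFourierFamily T n (fun k t ξ =>
      ∑ j ∈ Finset.univ, ((ξ l : ℝ) : ℂ) * ((ξ j : ℝ) : ℂ) / ((‖ξ‖ ^ 2 : ℝ) : ℂ) * G k t ξ j) :=
    IsFourierFamily.finset_sum Finset.univ fun j _ =>
      (hG j).symbol (m := fun ξ => ((ξ l : ℝ) : ℂ) * ((ξ j : ℝ) : ℂ) / ((‖ξ‖ ^ 2 : ℝ) : ℂ))
        (measurable_lerayCoeff l j).aestronglyMeasurable (d := 0) zero_le_one
        (fun ξ => by rw [pow_zero, mul_one]; exact norm_lerayCoeff_le_one ξ l j)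
  have h := (hG l).sub hsum
  refine ⟨fun k hk t ht => ?_, fun k hk K => ?_, fun k hk ξ => ?_, fun k hk ξ t ht => ?_⟩
  · exact (h.meas k hk t ht).congr (Eventually.of_forall fun ξ => (lerayPart_eq_sub_sum _ ξ l).symm)
  · obtain ⟨C, hC⟩ := h.decay k hk K
    refine ⟨C, fun t ht ξ => ?_⟩
    show ‖lerayPart (G k t) ξ l‖ ≤ C * ((1 + ‖ξ‖) ^ K)⁻¹
    rw [lerayPart_eq_sub_sum]
    exact hC t ht ξ
  · exact (h.cont k hk ξ).congr fun t _ => lerayPart_eq_sub_sum _ ξ l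
  · have hd := h.deriv k hk ξ t ht
    simp only at hd
    rw [← lerayPart_eq_sub_sum] at hd
    exact hd.congr (fun s _ => lerayPart_eq_sub_sum _ ξ l) (lerayPart_eq_sub_sum _ ξ l)

/-- **Square-dominated version**: the Leray projection of a square-dominated force tower is
square dominated (the shape consumed by the bootstrap `W_{k+1} = -c‖ξ‖²W_k − N(W,W)_k + B_k` of
the classical half). [cite: LemarieRieusset2016, §6.1] -/
theorem isDomFamily_lerayPart {T : ℝ} {n : ℕ} {G : ℕ → ℝ → EuclideanSpace ℝ ι → ι → ℂ}
    (hG : ∀ l, IsDomFamily T n (fun k t ξ => G k t ξ l)) (l : ι) :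
    IsDomFamily T n (fun k t ξ => lerayPart (G k t) ξ l) := by
  have hsum : IsDomFamily T n (fun k t ξ =>
      ∑ j ∈ Finset.univ, ((ξ l : ℝ) : ℂ) * ((ξ j : ℝ) : ℂ) / ((‖ξ‖ ^ 2 : ℝ) : ℂ) * G k t ξ j) :=
    IsDomFamily.finset_sum Finset.univ fun j _ =>
      (hG j).symbol (m := fun ξ => ((ξ l : ℝ) : ℂ) * ((ξ j : ℝ) : ℂ) / ((‖ξ‖ ^ 2 : ℝ) : ℂ))
        (measurable_lerayCoeff l j).aestronglyMeasurable (d := 0) zero_le_one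
        (fun ξ => by rw [pow_zero, mul_one]; exact norm_lerayCoeff_le_one ξ l j)
  have h := (hG l).sub hsum
  refine ⟨fun k hk t ht => ?_, fun k hk K => ?_, fun k hk ξ => ?_, fun k hk ξ t ht => ?_⟩
  · exact (h.meas k hk t ht).congr (Eventually.of_forall fun ξ => (lerayPart_eq_sub_sum _ ξ l).symm)
  · obtain ⟨Gd, hGd, hC⟩ := h.dom k hk K
    refine ⟨Gd, hGd, fun t ht ξ => ?_⟩
    show (1 + ‖ξ‖) ^ K * ‖lerayPart (G k t) ξ l‖ ≤ Gd ξ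
    rw [lerayPart_eq_sub_sum]
    exact hC t ht ξ
  · exact (h.cont k hk ξ).congr fun t _ => lerayPart_eq_sub_sum _ ξ l
  · have hd := h.deriv k hk ξ t ht
    simp only at hd
    rw [← lerayPart_eq_sub_sum] at hd
    exact hd.congr (fun s _ => lerayPart_eq_sub_sum _ ξ l) (lerayPart_eq_sub_sum _ ξ l)

/-- The Leray projection of a force tower is divergence free at every level (tree
`sum_mul_lerayPart`). [cite: LemarieRieusset2016, §6.1] -/
theorem sum_mul_lerayPart_tower (G : ℕ → ℝ → EuclideanSpace ℝ ι → ι → ℂ) (k : ℕ) (t : ℝ)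
    (ξ : EuclideanSpace ℝ ι) : ∑ l, ((ξ l : ℝ) : ℂ) * lerayPart (G k t) ξ l = 0 :=
  sum_mul_lerayPart _ ξ

/-- The Leray projection of a conjugation-symmetric force tower is conjugation symmetric at
every level (tree `lerayPart_neg`). [cite: LemarieRieusset2016, §6.1] -/
theorem lerayPart_tower_neg {G : ℕ → ℝ → EuclideanSpace ℝ ι → ι → ℂ}
    (hG : ∀ k t ξ l, G k t (-ξ) l = conj (G k t ξ l)) (k : ℕ) (t : ℝ) (ξ : EuclideanSpace ℝ ι)
    (l : ι) : lerayPart (G k t) (-ξ) l = conj (lerayPart (G k t) ξ l) :=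
  lerayPart_neg (hG k t) ξ l

end Leray

/-! ## §2 The force-pressure symbol `i (ξ·g)/(2π‖ξ‖²)` -/

section ForcePressure

/-- **The force-pressure symbol** — the Fourier multiplier form of Tao's `Δ⁻¹ ∇·f`, the force
term of the normalised pressure `p = -Δ⁻¹∂ᵢ∂ⱼ(uᵢuⱼ) + Δ⁻¹∇·f` (arXiv:1108.1165, (8)): with the
tree's dictionary `∂ₗ ↔ -2πi ξₗ` (so `Δ ↔ -4π²‖ξ‖²`, `∇· ↔ -2πi ξ·`), the transform of
`Δ⁻¹∇·f` at a raw Fourier force `g = 𝓕⁻¹ f` is `(-2πi ξ·g)/(-4π²‖ξ‖²) = i (ξ·g)/(2π‖ξ‖²)`.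
Written with the real inverse `(2π‖ξ‖²)⁻¹` (value `0` at `ξ = 0`). [cite: Tao2011, (8) p. 3] -/
def forcePresSymbol (g : EuclideanSpace ℝ ι → ι → ℂ) (ξ : EuclideanSpace ℝ ι) : ℂ :=
  (I * (((2 * π * ‖ξ‖ ^ 2)⁻¹ : ℝ) : ℂ)) * ∑ k, ((ξ k : ℝ) : ℂ) * g ξ k

/-- Unfolding `forcePresSymbol`. [cite: Tao2011, (8) p. 3] -/
theorem forcePresSymbol_apply (g : EuclideanSpace ℝ ι → ι → ℂ) (ξ : EuclideanSpace ℝ ι) :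
    forcePresSymbol g ξ = (I * (((2 * π * ‖ξ‖ ^ 2)⁻¹ : ℝ) : ℂ)) * ∑ k, ((ξ k : ℝ) : ℂ) * g ξ k :=
  rfl

/-- The force-pressure symbol vanishes at the zero frequency. [cite: Tao2011, (8) p. 3] -/
theorem forcePresSymbol_zero (g : EuclideanSpace ℝ ι → ι → ℂ) : forcePresSymbol g 0 = 0 := by
  simp [forcePresSymbol]

/-- **The letter identity `∇ Δ⁻¹∇·f = f − P f` on the Fourier side**:
`(-2πi ξₗ) · forcePresSymbol g ξ = g ξ l − lerayPart g ξ l`. [cite: Tao2011, (8) p. 3] -/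
theorem letter_mul_forcePresSymbol (g : EuclideanSpace ℝ ι → ι → ℂ) (ξ : EuclideanSpace ℝ ι)
    (l : ι) :
    (-(2 * π * I) * ((ξ l : ℝ) : ℂ)) * forcePresSymbol g ξ = g ξ l - lerayPart g ξ l := by
  rw [lerayPart, sub_sub_cancel, forcePresSymbol]
  by_cases hξ : ξ = 0
  · subst hξ
    simp
  · have hr : ((‖ξ‖ : ℝ) : ℂ) ≠ 0 := by exact_mod_cast (norm_pos_iff.2 hξ).ne'
    have hπ : (π : ℂ) ≠ 0 := by exact_mod_cast Real.pi_ne_zero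
    have key : (-(2 * π * I) * ((ξ l : ℝ) : ℂ)) * (I * (((2 * π * ‖ξ‖ ^ 2)⁻¹ : ℝ) : ℂ)) =
        ((ξ l : ℝ) : ℂ) / ((‖ξ‖ ^ 2 : ℝ) : ℂ) := by
      push_cast
      field_simp
      ring_nf
      rw [Complex.I_sq]
      ring
    rw [← mul_assoc, key, div_mul_eq_mul_div]

/-- **Conjugation symmetry of the force-pressure symbol** (reality of `Δ⁻¹∇·f`) for a
conjugation-symmetric raw force. [cite: Tao2011, (8) p. 3] -/
theorem forcePresSymbol_neg {g : EuclideanSpace ℝ ι → ι → ℂ} (hg : ∀ ξ l, g (-ξ) l = conj (g ξ l))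
    (ξ : EuclideanSpace ℝ ι) : forcePresSymbol g (-ξ) = conj (forcePresSymbol g ξ) := by
  simp only [forcePresSymbol, hg, PiLp.neg_apply, Complex.ofReal_neg, norm_neg, map_mul, map_sum,
    Complex.conj_ofReal, Complex.conj_I]
  have hsum : ∑ x, -((ξ x : ℝ) : ℂ) * conj (g ξ x) = -∑ x, ((ξ x : ℝ) : ℂ) * conj (g ξ x) := by
    rw [← Finset.sum_neg_distrib]
    refine Finset.sum_congr rfl fun x _ => ?_
    ring
  rw [hsum]
  ring

/-- The scalar `∑ₖ ξₖ gₖ(ξ)` is bounded by `card ι ‖ξ‖ ‖g ξ‖`. [folklore] -/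
private theorem norm_sum_coord_mul_le (g : EuclideanSpace ℝ ι → ι → ℂ) (ξ : EuclideanSpace ℝ ι) :
    ‖∑ k, ((ξ k : ℝ) : ℂ) * g ξ k‖ ≤ Fintype.card ι * (‖ξ‖ * ‖g ξ‖) := by
  calc ‖∑ k, ((ξ k : ℝ) : ℂ) * g ξ k‖ ≤ ∑ k, ‖((ξ k : ℝ) : ℂ) * g ξ k‖ := norm_sum_le _ _
    _ ≤ ∑ _k : ι, ‖ξ‖ * ‖g ξ‖ := Finset.sum_le_sum fun k _ => by
        rw [norm_mul, Complex.norm_real]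
        exact mul_le_mul (PiLp.norm_apply_le ξ k) (norm_le_pi_norm (g ξ) k) (norm_nonneg _)
          (norm_nonneg _)
    _ = Fintype.card ι * (‖ξ‖ * ‖g ξ‖) := by
        rw [Finset.sum_const, Finset.card_univ, nsmul_eq_mul]

/-- Componentwise form: `‖∑ₖ ξₖ gₖ(ξ)‖ ≤ ‖ξ‖ ∑ₖ ‖gₖ(ξ)‖`. [folklore] -/
private theorem norm_sum_coord_mul_le_sum (g : EuclideanSpace ℝ ι → ι → ℂ) (ξ : EuclideanSpace ℝ ι) :
    ‖∑ k, ((ξ k : ℝ) : ℂ) * g ξ k‖ ≤ ‖ξ‖ * ∑ k, ‖g ξ k‖ := by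
  rw [Finset.mul_sum]
  calc ‖∑ k, ((ξ k : ℝ) : ℂ) * g ξ k‖ ≤ ∑ k, ‖((ξ k : ℝ) : ℂ) * g ξ k‖ := norm_sum_le _ _
    _ ≤ ∑ k, ‖ξ‖ * ‖g ξ k‖ := Finset.sum_le_sum fun k _ => by
        rw [norm_mul, Complex.norm_real]
        exact mul_le_mul_of_nonneg_right (PiLp.norm_apply_le ξ k) (norm_nonneg _)

/-- The norm of the prefactor `i (2π‖ξ‖²)⁻¹`. [folklore] -/
private theorem norm_forcePresPrefactor (ξ : EuclideanSpace ℝ ι) :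
    ‖I * (((2 * π * ‖ξ‖ ^ 2)⁻¹ : ℝ) : ℂ)‖ = (2 * π * ‖ξ‖ ^ 2)⁻¹ := by
  rw [norm_mul, Complex.norm_I, one_mul, Complex.norm_real, Real.norm_of_nonneg (by positivity)]

/-- **Pointwise bound of the force-pressure symbol**:
`‖forcePresSymbol g ξ‖ ≤ (card ι / 2π) ‖ξ‖⁻¹ ‖g ξ‖` — one negative power of `‖ξ‖`, so this is
not a `HasDecay` bound near `ξ = 0`. [cite: Tao2011, (8) p. 3] -/
theorem norm_forcePresSymbol_le (g : EuclideanSpace ℝ ι → ι → ℂ) (ξ : EuclideanSpace ℝ ι) :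
    ‖forcePresSymbol g ξ‖ ≤ Fintype.card ι / (2 * π) * (‖ξ‖⁻¹ * ‖g ξ‖) := by
  by_cases hξ : ξ = 0
  · subst hξ
    rw [forcePresSymbol_zero, norm_zero]
    positivity
  · have hn : 0 < ‖ξ‖ := norm_pos_iff.2 hξ
    rw [forcePresSymbol, norm_mul, norm_forcePresPrefactor]
    calc (2 * π * ‖ξ‖ ^ 2)⁻¹ * ‖∑ k, ((ξ k : ℝ) : ℂ) * g ξ k‖
        ≤ (2 * π * ‖ξ‖ ^ 2)⁻¹ * (Fintype.card ι * (‖ξ‖ * ‖g ξ‖)) :=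
          mul_le_mul_of_nonneg_left (norm_sum_coord_mul_le g ξ) (by positivity)
      _ = Fintype.card ι / (2 * π) * (‖ξ‖⁻¹ * ‖g ξ‖) := by
          field_simp

/-- Componentwise pointwise bound:
`‖forcePresSymbol g ξ‖ ≤ (2π)⁻¹ ‖ξ‖⁻¹ ∑ₖ ‖gₖ(ξ)‖`. [cite: Tao2011, (8) p. 3] -/
theorem norm_forcePresSymbol_le_sum (g : EuclideanSpace ℝ ι → ι → ℂ) (ξ : EuclideanSpace ℝ ι) :
    ‖forcePresSymbol g ξ‖ ≤ (2 * π)⁻¹ * ‖ξ‖⁻¹ * ∑ k, ‖g ξ k‖ := by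
  by_cases hξ : ξ = 0
  · subst hξ
    rw [forcePresSymbol_zero, norm_zero]
    positivity
  · have hn : 0 < ‖ξ‖ := norm_pos_iff.2 hξ
    rw [forcePresSymbol, norm_mul, norm_forcePresPrefactor]
    calc (2 * π * ‖ξ‖ ^ 2)⁻¹ * ‖∑ k, ((ξ k : ℝ) : ℂ) * g ξ k‖
        ≤ (2 * π * ‖ξ‖ ^ 2)⁻¹ * (‖ξ‖ * ∑ k, ‖g ξ k‖) :=
          mul_le_mul_of_nonneg_left (norm_sum_coord_mul_le_sum g ξ) (by positivity)
      _ = (2 * π)⁻¹ * ‖ξ‖⁻¹ * ∑ k, ‖g ξ k‖ := by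
          field_simp

/-- **The force-pressure symbol of a decaying force**: if `‖g ξ‖ ≤ B (1+‖ξ‖)^{-(m+K)}` then
`‖ξ‖ᵐ ‖forcePresSymbol g ξ‖ ≤ (card ι B / 2π) ‖ξ‖⁻¹ (1+‖ξ‖)^{-K}` — all moments are dominated by
the one singular weight `‖ξ‖⁻¹ (1+‖ξ‖)^{-K}`. [cite: Tao2011, (8) p. 3] -/
theorem pow_mul_norm_forcePresSymbol_le {m K : ℕ} {B : ℝ} {g : EuclideanSpace ℝ ι → ι → ℂ}
    (hg : HasDecay (m + K) B g) (ξ : EuclideanSpace ℝ ι) :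
    ‖ξ‖ ^ m * ‖forcePresSymbol g ξ‖ ≤
      Fintype.card ι * B / (2 * π) * (‖ξ‖⁻¹ * ((1 + ‖ξ‖) ^ K)⁻¹) := by
  have h1 := norm_forcePresSymbol_le g ξ
  have h2 : ‖ξ‖ ^ m * ‖g ξ‖ ≤ B * ((1 + ‖ξ‖) ^ K)⁻¹ := hg.pow_mul_norm_le ξ
  calc ‖ξ‖ ^ m * ‖forcePresSymbol g ξ‖
      ≤ ‖ξ‖ ^ m * (Fintype.card ι / (2 * π) * (‖ξ‖⁻¹ * ‖g ξ‖)) :=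
        mul_le_mul_of_nonneg_left h1 (by positivity)
    _ = Fintype.card ι / (2 * π) * ‖ξ‖⁻¹ * (‖ξ‖ ^ m * ‖g ξ‖) := by ring
    _ ≤ Fintype.card ι / (2 * π) * ‖ξ‖⁻¹ * (B * ((1 + ‖ξ‖) ^ K)⁻¹) :=
        mul_le_mul_of_nonneg_left h2 (by positivity)
    _ = Fintype.card ι * B / (2 * π) * (‖ξ‖⁻¹ * ((1 + ‖ξ‖) ^ K)⁻¹) := by ring

/-- Weighted form: if `‖g ξ‖ ≤ B (1+‖ξ‖)^{-(m+K)}` then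
`(1+‖ξ‖)ᵐ ‖forcePresSymbol g ξ‖ ≤ (card ι B / 2π) ‖ξ‖⁻¹ (1+‖ξ‖)^{-K}`. [cite: Tao2011, (8) p. 3] -/
theorem one_add_pow_mul_norm_forcePresSymbol_le {m K : ℕ} {B : ℝ}
    {g : EuclideanSpace ℝ ι → ι → ℂ} (hg : HasDecay (m + K) B g) (ξ : EuclideanSpace ℝ ι) :
    (1 + ‖ξ‖) ^ m * ‖forcePresSymbol g ξ‖ ≤
      Fintype.card ι * B / (2 * π) * (‖ξ‖⁻¹ * ((1 + ‖ξ‖) ^ K)⁻¹) := by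
  have h1 := norm_forcePresSymbol_le g ξ
  have hpos : 0 < (1 + ‖ξ‖) ^ m := by positivity
  have h2 : (1 + ‖ξ‖) ^ m * ‖g ξ‖ ≤ B * ((1 + ‖ξ‖) ^ K)⁻¹ := by
    have := hg ξ
    rw [pow_add, mul_inv] at this
    calc (1 + ‖ξ‖) ^ m * ‖g ξ‖ ≤ (1 + ‖ξ‖) ^ m * (B * (((1 + ‖ξ‖) ^ m)⁻¹ * ((1 + ‖ξ‖) ^ K)⁻¹)) :=
          mul_le_mul_of_nonneg_left this hpos.le
      _ = B * ((1 + ‖ξ‖) ^ K)⁻¹ := by field_simp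
  calc (1 + ‖ξ‖) ^ m * ‖forcePresSymbol g ξ‖
      ≤ (1 + ‖ξ‖) ^ m * (Fintype.card ι / (2 * π) * (‖ξ‖⁻¹ * ‖g ξ‖)) :=
        mul_le_mul_of_nonneg_left h1 hpos.le
    _ = Fintype.card ι / (2 * π) * ‖ξ‖⁻¹ * ((1 + ‖ξ‖) ^ m * ‖g ξ‖) := by ring
    _ ≤ Fintype.card ι / (2 * π) * ‖ξ‖⁻¹ * (B * ((1 + ‖ξ‖) ^ K)⁻¹) :=
        mul_le_mul_of_nonneg_left h2 (by positivity)
    _ = Fintype.card ι * B / (2 * π) * (‖ξ‖⁻¹ * ((1 + ‖ξ‖) ^ K)⁻¹) := by ring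

/-- The prefactor `ξ ↦ i (2π‖ξ‖²)⁻¹` is measurable. [folklore] -/
private theorem measurable_forcePresPrefactor :
    Measurable fun ξ : EuclideanSpace ℝ ι => I * (((2 * π * ‖ξ‖ ^ 2)⁻¹ : ℝ) : ℂ) := by
  have h : Measurable fun ξ : EuclideanSpace ℝ ι => (2 * π * ‖ξ‖ ^ 2)⁻¹ :=
    (measurable_const.mul (measurable_norm.pow_const 2)).inv
  exact measurable_const.mul (Complex.measurable_ofReal.comp h)

/-- Measurability of the force-pressure symbol from measurability of the force components. [cite: Tao2011, (8) p. 3] -/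
theorem aestronglyMeasurable_forcePresSymbol {g : EuclideanSpace ℝ ι → ι → ℂ}
    (hg : ∀ k, AEStronglyMeasurable (fun ξ => g ξ k) volume) :
    AEStronglyMeasurable (forcePresSymbol g) volume := by
  have hc : ∀ k, Continuous fun ξ : EuclideanSpace ℝ ι => ((ξ k : ℝ) : ℂ) := fun k => by fun_prop
  exact measurable_forcePresPrefactor.aestronglyMeasurable.mul
    (Finset.aestronglyMeasurable_fun_sum _ fun k _ =>
      (show AEStronglyMeasurable (fun ξ => ((ξ k : ℝ) : ℂ) * g ξ k) volume from
        (hc k).aestronglyMeasurable.mul (hg k)))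

/-- Continuity in time of the force-pressure symbol of a time-dependent force at a fixed
frequency. [cite: Tao2011, (8) p. 3] -/
theorem continuousOn_forcePresSymbol_time {S : Set ℝ} {g : ℝ → EuclideanSpace ℝ ι → ι → ℂ}
    {ξ : EuclideanSpace ℝ ι} (hg : ∀ k, ContinuousOn (fun t => g t ξ k) S) :
    ContinuousOn (fun t => forcePresSymbol (g t) ξ) S :=
  continuousOn_const.mul (continuousOn_finsetSum _ fun k _ => continuousOn_const.mul (hg k))

/-- Time derivative of the force-pressure symbol along a differentiable force (linearity). [cite: Tao2011, (8) p. 3] -/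
theorem hasDerivWithinAt_forcePresSymbol_time {S : Set ℝ} {g g' : ℝ → EuclideanSpace ℝ ι → ι → ℂ}
    {ξ : EuclideanSpace ℝ ι} {t : ℝ}
    (hg : ∀ k, HasDerivWithinAt (fun s => g s ξ k) (g' t ξ k) S t) :
    HasDerivWithinAt (fun s => forcePresSymbol (g s) ξ) (forcePresSymbol (g' t) ξ) S t := by
  unfold forcePresSymbol
  exact (HasDerivWithinAt.fun_sum fun k _ => (hg k).const_mul _).const_mul _

end ForcePressure

/-! ## §3 The singular weight `‖ξ‖⁻¹ (1 + ‖ξ‖)^{-K}` on `ℝ³` -/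

section SingularWeight

/-- **`‖ξ‖⁻¹ (1+‖ξ‖)^{-K} ∈ L¹(ℝ³)` for `K ≥ 5`** (`1 < 3` at the origin, `K - 1 > 3` at
infinity; the tree's `HomSobolev.integrable_norm_rpow_neg_mul_one_add_norm_rpow_neg`; Bahouri–Chemin–Danchin
2011, proof of Prop. 1.34: `|ξ|^{-a}` is integrable on the unit ball iff `a < d`). [cite: BahouriCheminDanchin2011, Prop. 1.34 (proof)] -/
theorem integrable_inv_norm_mul_inv_one_add_norm_pow {K : ℕ} (hK : 5 ≤ K) :
    Integrable (fun ξ : EuclideanSpace ℝ (Fin 3) => ‖ξ‖⁻¹ * ((1 + ‖ξ‖) ^ K)⁻¹) volume := by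
  have hE : 0 < Module.finrank ℝ (EuclideanSpace ℝ (Fin 3)) := by
    rw [finrank_euclideanSpace_fin]; norm_num
  have h := FunctionSpaces.HomSobolev.integrable_norm_rpow_neg_mul_one_add_norm_rpow_neg
    (E := EuclideanSpace ℝ (Fin 3)) hE (a := 1) (r := K)
    (by rw [finrank_euclideanSpace_fin]; norm_num)
    (by rw [finrank_euclideanSpace_fin, abs_one]; exact_mod_cast (by omega : 4 < K))
  refine h.congr (Eventually.of_forall fun ξ => ?_)
  simp only
  rw [Real.rpow_neg_one, Real.rpow_neg (by positivity), Real.rpow_natCast]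

/-- **`‖ξ‖⁻² (1+‖ξ‖)^{-K} ∈ L¹(ℝ³)` for `K ≥ 6`** (`2 < 3` at the origin). [cite: BahouriCheminDanchin2011, Prop. 1.34 (proof)] -/
theorem integrable_inv_norm_sq_mul_inv_one_add_norm_pow {K : ℕ} (hK : 6 ≤ K) :
    Integrable (fun ξ : EuclideanSpace ℝ (Fin 3) => (‖ξ‖ ^ 2)⁻¹ * ((1 + ‖ξ‖) ^ K)⁻¹) volume := by
  have hE : 0 < Module.finrank ℝ (EuclideanSpace ℝ (Fin 3)) := by
    rw [finrank_euclideanSpace_fin]; norm_num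
  have h := FunctionSpaces.HomSobolev.integrable_norm_rpow_neg_mul_one_add_norm_rpow_neg
    (E := EuclideanSpace ℝ (Fin 3)) hE (a := 2) (r := K)
    (by rw [finrank_euclideanSpace_fin]; norm_num)
    (by rw [finrank_euclideanSpace_fin, abs_two]; exact_mod_cast (by omega : 5 < K))
  refine h.congr (Eventually.of_forall fun ξ => ?_)
  simp only
  rw [Real.rpow_neg (norm_nonneg _), Real.rpow_neg (by positivity), Real.rpow_natCast,
    Real.rpow_two]

/-- **`‖ξ‖⁻¹ (1+‖ξ‖)^{-K} ∈ L²(ℝ³)` for `K ≥ 3`.** [cite: BahouriCheminDanchin2011, Prop. 1.34 (proof)] -/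
theorem memLp_two_inv_norm_mul_inv_one_add_norm_pow {K : ℕ} (hK : 3 ≤ K) :
    MemLp (fun ξ : EuclideanSpace ℝ (Fin 3) => ‖ξ‖⁻¹ * ((1 + ‖ξ‖) ^ K)⁻¹) 2 volume := by
  have hmeas : AEStronglyMeasurable
      (fun ξ : EuclideanSpace ℝ (Fin 3) => ‖ξ‖⁻¹ * ((1 + ‖ξ‖) ^ K)⁻¹) volume :=
    (measurable_norm.inv.mul ((measurable_const.add measurable_norm).pow_const K).inv)
      |>.aestronglyMeasurable
  refine (memLp_two_iff_integrable_sq hmeas).2 ?_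
  refine (integrable_inv_norm_sq_mul_inv_one_add_norm_pow (K := 2 * K) (by omega)).congr
    (Eventually.of_forall fun ξ => ?_)
  simp only
  rw [mul_pow, inv_pow, inv_pow, ← pow_mul, mul_comm K 2]

/-- Constant multiples of the singular weight are square integrable. [cite: BahouriCheminDanchin2011, Prop. 1.34 (proof)] -/
theorem memLp_two_const_mul_singularWeight {K : ℕ} (hK : 3 ≤ K) (c : ℝ) :
    MemLp (fun ξ : EuclideanSpace ℝ (Fin 3) => c * (‖ξ‖⁻¹ * ((1 + ‖ξ‖) ^ K)⁻¹)) 2 volume :=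
  (memLp_two_inv_norm_mul_inv_one_add_norm_pow hK).const_mul c

variable {g : EuclideanSpace ℝ (Fin 3) → Fin 3 → ℂ} {K : ℕ} {B : ℝ}

/-- **Integrable moments of every order of the force-pressure symbol on `ℝ³`**: if
`‖g ξ‖ ≤ B (1+‖ξ‖)^{-(m+K)}` with `K ≥ 5` then `‖ξ‖ᵐ ‖forcePresSymbol g ξ‖ ∈ L¹`. [cite: Tao2011, (8) p. 3] -/
theorem integrable_pow_mul_norm_forcePresSymbol {m : ℕ} (hg : HasDecay (m + K) B g) (hK : 5 ≤ K)
    (hgm : ∀ k, AEStronglyMeasurable (fun ξ => g ξ k) volume) :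
    Integrable (fun ξ => ‖ξ‖ ^ m * ‖forcePresSymbol g ξ‖) volume := by
  refine ((integrable_inv_norm_mul_inv_one_add_norm_pow hK).const_mul
    (Fintype.card (Fin 3) * B / (2 * π))).mono'
    ((continuous_norm.pow m).aestronglyMeasurable.mul (aestronglyMeasurable_forcePresSymbol hgm).norm)
    (Eventually.of_forall fun ξ => ?_)
  rw [Real.norm_of_nonneg (by positivity)]
  exact pow_mul_norm_forcePresSymbol_le hg ξ

/-- The force-pressure symbol of a decaying force on `ℝ³` is integrable (`K ≥ 5`). [cite: Tao2011, (8) p. 3] -/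
theorem integrable_forcePresSymbol (hg : HasDecay K B g) (hK : 5 ≤ K)
    (hgm : ∀ k, AEStronglyMeasurable (fun ξ => g ξ k) volume) :
    Integrable (forcePresSymbol g) volume := by
  have h := integrable_pow_mul_norm_forcePresSymbol (m := 0) (by simpa using hg) hK hgm
  simp only [pow_zero, one_mul] at h
  exact (integrable_norm_iff (aestronglyMeasurable_forcePresSymbol hgm)).1 h

/-- The first moment `‖ξ‖ ‖forcePresSymbol g ξ‖` is integrable (`K ≥ 5`, decay of order
`1 + K`). [cite: Tao2011, (8) p. 3] -/
theorem integrable_norm_mul_norm_forcePresSymbol (hg : HasDecay (1 + K) B g) (hK : 5 ≤ K)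
    (hgm : ∀ k, AEStronglyMeasurable (fun ξ => g ξ k) volume) :
    Integrable (fun ξ => ‖ξ‖ * ‖forcePresSymbol g ξ‖) volume := by
  simpa using integrable_pow_mul_norm_forcePresSymbol (m := 1) hg hK hgm

/-- **Square-integrable envelopes of every order of the force-pressure symbol on `ℝ³`**:
`‖ξ‖ᵐ ‖forcePresSymbol g ξ‖ ≤ G(ξ)` with `G = (3B/2π) ‖ξ‖⁻¹ (1+‖ξ‖)^{-K} ∈ L²` (`K ≥ 3`). [cite: Tao2011, (8) p. 3] -/
theorem exists_env_forcePresSymbol {m : ℕ} (hg : HasDecay (m + K) B g) (hK : 3 ≤ K) :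
    ∃ G : EuclideanSpace ℝ (Fin 3) → ℝ, MemLp G 2 volume ∧
      ∀ ξ, ‖ξ‖ ^ m * ‖forcePresSymbol g ξ‖ ≤ G ξ :=
  ⟨fun ξ => Fintype.card (Fin 3) * B / (2 * π) * (‖ξ‖⁻¹ * ((1 + ‖ξ‖) ^ K)⁻¹),
    memLp_two_const_mul_singularWeight hK _, fun ξ => pow_mul_norm_forcePresSymbol_le hg ξ⟩

/-- The force-pressure symbol of a decaying force on `ℝ³` is square integrable (`K ≥ 3`). [cite: Tao2011, (8) p. 3] -/
theorem memLp_two_forcePresSymbol (hg : HasDecay K B g) (hK : 3 ≤ K)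
    (hgm : ∀ k, AEStronglyMeasurable (fun ξ => g ξ k) volume) :
    MemLp (forcePresSymbol g) 2 volume := by
  obtain ⟨G, hG, hle⟩ := exists_env_forcePresSymbol (m := 0) (by simpa using hg) hK
  refine MemLp.of_le hG.norm (aestronglyMeasurable_forcePresSymbol hgm)
    (Eventually.of_forall fun ξ => ?_)
  have h1 := hle ξ
  rw [pow_zero, one_mul] at h1
  rw [norm_norm, Real.norm_eq_abs, abs_of_nonneg ((norm_nonneg _).trans h1)]
  exact h1

end SingularWeight

/-! ## §4 The force-pressure tower and the joint smoothness of the force pressure on `ℝ³` -/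

section Tower

/-- **The force-pressure tower of a pointwise-decaying force tower on `ℝ³` is square dominated**
(`IsDomFamily`): measurable slices, `L²` dominators
`(∑ₗ Cₗ / 2π) ‖ξ‖⁻¹ (1+‖ξ‖)^{-3}` of every order, continuity and the derivative relations in time
(linearity of `forcePresSymbol`). [cite: Tao2011, Thm. 5.4 (iv) with (8)] -/
theorem isDomFamily_forcePresSymbol {T : ℝ} {n : ℕ}
    {G : ℕ → ℝ → EuclideanSpace ℝ (Fin 3) → Fin 3 → ℂ}
    (hG : ∀ l, IsFourierFamily T n (fun k t ξ => G k t ξ l)) :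
    IsDomFamily T n (fun k t ξ => forcePresSymbol (G k t) ξ) where
  meas k hk t ht := aestronglyMeasurable_forcePresSymbol fun l => (hG l).meas k hk t ht
  dom k hk K := by
    classical
    choose C hC using fun l => (hG l).decay k hk (K + 3)
    refine ⟨fun ξ => (∑ l, C l) / (2 * π) * (‖ξ‖⁻¹ * ((1 + ‖ξ‖) ^ 3)⁻¹),
      memLp_two_const_mul_singularWeight le_rfl _, fun t ht ξ => ?_⟩
    have hpos : 0 < (1 + ‖ξ‖) ^ K := by positivity
    have hcomp : ∀ l, (1 + ‖ξ‖) ^ K * ‖G k t ξ l‖ ≤ C l * ((1 + ‖ξ‖) ^ 3)⁻¹ := fun l => by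
      have := hC l t ht ξ
      rw [pow_add, mul_inv] at this
      calc (1 + ‖ξ‖) ^ K * ‖G k t ξ l‖
          ≤ (1 + ‖ξ‖) ^ K * (C l * (((1 + ‖ξ‖) ^ K)⁻¹ * ((1 + ‖ξ‖) ^ 3)⁻¹)) :=
            mul_le_mul_of_nonneg_left this hpos.le
        _ = C l * ((1 + ‖ξ‖) ^ 3)⁻¹ := by field_simp
    calc (1 + ‖ξ‖) ^ K * ‖forcePresSymbol (G k t) ξ‖
        ≤ (1 + ‖ξ‖) ^ K * ((2 * π)⁻¹ * ‖ξ‖⁻¹ * ∑ l, ‖G k t ξ l‖) :=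
          mul_le_mul_of_nonneg_left (norm_forcePresSymbol_le_sum _ ξ) hpos.le
      _ = (2 * π)⁻¹ * ‖ξ‖⁻¹ * ∑ l, (1 + ‖ξ‖) ^ K * ‖G k t ξ l‖ := by
          rw [Finset.mul_sum, Finset.mul_sum, Finset.mul_sum]
          refine Finset.sum_congr rfl fun l _ => ?_
          ring
      _ ≤ (2 * π)⁻¹ * ‖ξ‖⁻¹ * ∑ l, C l * ((1 + ‖ξ‖) ^ 3)⁻¹ :=
          mul_le_mul_of_nonneg_left (Finset.sum_le_sum fun l _ => hcomp l) (by positivity)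
      _ = (∑ l, C l) / (2 * π) * (‖ξ‖⁻¹ * ((1 + ‖ξ‖) ^ 3)⁻¹) := by
          rw [← Finset.sum_mul]
          ring
  cont k hk ξ := continuousOn_forcePresSymbol_time fun l => (hG l).cont k hk ξ
  deriv k hk ξ t ht := hasDerivWithinAt_forcePresSymbol_time fun l => (hG l).deriv k hk ξ t ht

/-- **The force pressure `p_f(t) = Re 𝓕 forcePresSymbol (g t)` is jointly smooth on the closed
slab `[0, T] × ℝ³`** whenever the raw force has pointwise-decaying time-derivative towers of every
order (Tao 2011, Thm. 5.4 (iv): "`p` is smooth … `∂ₜʲ p ∈ L^∞_t H^k_x` for all `j, k`"; the tree's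
synthesis theorem `contDiffOn_synth_infty_dom`). [cite: Tao2011, Thm. 5.4 (iv) with (8)] -/
theorem isSmoothSpaceTimeOn_forcePressure {T : ℝ} (hT : 0 < T)
    {g : ℝ → EuclideanSpace ℝ (Fin 3) → Fin 3 → ℂ}
    (hall : ∀ n : ℕ, ∃ G : ℕ → ℝ → EuclideanSpace ℝ (Fin 3) → Fin 3 → ℂ, G 0 = g ∧
      ∀ l, IsFourierFamily T n (fun k t ξ => G k t ξ l)) :
    IsSmoothSpaceTimeOn (Icc 0 T) (fun t x => (𝓕 (forcePresSymbol (g t)) x).re) := by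
  unfold IsSmoothSpaceTimeOn
  have h1 : ContDiffOn ℝ ∞
      (fun z : ℝ × EuclideanSpace ℝ (Fin 3) => 𝓕 (forcePresSymbol (g z.1)) z.2)
      (Icc 0 T ×ˢ univ) := by
    refine contDiffOn_synth_infty_dom (W₀ := fun t => forcePresSymbol (g t)) hT fun n => ?_
    obtain ⟨G, hG0, hG⟩ := hall n
    exact ⟨fun k t ξ => forcePresSymbol (G k t) ξ, by funext t ξ; simp only [hG0],
      isDomFamily_forcePresSymbol hG⟩
  exact Complex.reCLM.contDiff.comp_contDiffOn h1

end Tower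

/-! ## §5a Sobolev bounds of a scalar synthesis under MOMENT hypotheses

The tree's `lintegral_sq_norm_iteratedFDeriv_re_fourier_le` (`NSFourierTaoClass`) asks every
pointwise decay of the symbol; the force-pressure symbol has none at `ξ = 0`, but it has
integrable moments of every order and square-integrable envelopes, which is all Plancherel needs. -/

section ScalarMoments

variable [DecidableEq ι] {q : EuclideanSpace ℝ ι → ℂ}

omit [DecidableEq ι] in
/-- **`Re 𝓕 q` is smooth** for a symbol with integrable moments of every order (Mathlib
`Real.contDiff_fourier`; Tao 2011, Thm. 5.4 (iv): smoothness from `H^k` bounds of every order). [cite: Tao2011, Thm. 5.4 (iv)] -/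
theorem contDiff_re_fourier_of_moments
    (hmom : ∀ k : ℕ, Integrable (fun ξ : EuclideanSpace ℝ ι => ‖ξ‖ ^ k * ‖q ξ‖) volume) :
    ContDiff ℝ ∞ fun y => (𝓕 q y).re := by
  refine contDiff_infty.2 fun n => ?_
  exact Complex.reCLM.contDiff.comp (Real.contDiff_fourier fun m _ => hmom m)

/-- **Word derivatives of a scalar synthesis under moment hypotheses**:
`∂^α Re 𝓕 q = Re 𝓕 (dsym α · q)` (one letter at a time, the tree's
`pderiv_re_fourier_of_integrable`; Leray 1934, §19, (1.17)–(1.19)). [cite: Leray1934, §19] -/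
theorem ipderiv_re_fourier_eq_of_moments (hqm : AEStronglyMeasurable q volume)
    (hmom : ∀ k : ℕ, Integrable (fun ξ : EuclideanSpace ℝ ι => ‖ξ‖ ^ k * ‖q ξ‖) volume) :
    ∀ {m : ℕ} (α : Fin m → ι),
      ipderiv α (fun y => (𝓕 q y).re) = fun x => (𝓕 (fun ξ => dsym α ξ * q ξ) x).re
  | 0, α => by
      funext x
      simp
  | m + 1, α => by
      rw [ipderiv_succ, ipderiv_re_fourier_eq_of_moments hqm hmom (Fin.tail α)]
      have hgm : AEStronglyMeasurable (fun ξ => dsym (Fin.tail α) ξ * q ξ) volume :=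
        (continuous_dsym _).aestronglyMeasurable.mul hqm
      have hg : Integrable (fun ξ => dsym (Fin.tail α) ξ * q ξ) volume := by
        have := integrable_pow_mul_norm_dsym_mul hmom hqm (Fin.tail α) 0
        simp only [pow_zero, one_mul] at this
        exact (integrable_norm_iff hgm).1 this
      have hg1 : Integrable (fun ξ : EuclideanSpace ℝ ι => ‖ξ‖ * ‖dsym (Fin.tail α) ξ * q ξ‖)
          volume := by
        have := integrable_pow_mul_norm_dsym_mul hmom hqm (Fin.tail α) 1
        simpa only [pow_one] using this
      rw [pderiv_re_fourier_of_integrable hg hg1 (α 0)]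
      funext x
      congr 2
      refine congrFun (fourier_congr' fun ξ => ?_) x
      rw [dsym_succ]
      ring

omit [DecidableEq ι] in
/-- The symbol-weighted function `dsym α · q` is in `L¹ ∩ L²` when `q` has integrable moments and
an `L²` envelope of order `m = |α|`: `‖dsym α ξ · q ξ‖ ≤ (2π)ᵐ G ξ`. [cite: Leray1934, §19] -/
theorem memLp_two_dsym_mul_of_env (hqm : AEStronglyMeasurable q volume) {m : ℕ} (α : Fin m → ι)
    {G : EuclideanSpace ℝ ι → ℝ} (hG : MemLp G 2 volume) (hle : ∀ ξ, ‖ξ‖ ^ m * ‖q ξ‖ ≤ G ξ) :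
    MemLp (fun ξ => dsym α ξ * q ξ) 2 volume := by
  refine MemLp.of_le (hG.const_mul ((2 * π) ^ m)).norm
    ((continuous_dsym _).aestronglyMeasurable.mul hqm) (Eventually.of_forall fun ξ => ?_)
  have hG0 : 0 ≤ G ξ := le_trans (by positivity) (hle ξ)
  rw [norm_norm, Real.norm_of_nonneg (by positivity), norm_mul]
  calc ‖dsym α ξ‖ * ‖q ξ‖ ≤ (2 * π * ‖ξ‖) ^ m * ‖q ξ‖ :=
        mul_le_mul_of_nonneg_right (norm_dsym_le α ξ) (norm_nonneg _)
    _ = (2 * π) ^ m * (‖ξ‖ ^ m * ‖q ξ‖) := by rw [mul_pow]; ring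
    _ ≤ (2 * π) ^ m * G ξ := mul_le_mul_of_nonneg_left (hle ξ) (by positivity)

/-- **Plancherel bound for one word derivative of a scalar synthesis under moment hypotheses**:
`∫ (∂^α Re 𝓕 q)² ≤ (2π)^{2m} ∫ G²` for an `L²` envelope `‖ξ‖ᵐ ‖q ξ‖ ≤ G ξ` (Plancherel). [cite: Leray1934, §19] -/
theorem lintegral_ipderiv_re_fourier_sq_le_of_env (hqm : AEStronglyMeasurable q volume)
    (hmom : ∀ k : ℕ, Integrable (fun ξ : EuclideanSpace ℝ ι => ‖ξ‖ ^ k * ‖q ξ‖) volume)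
    {m : ℕ} (α : Fin m → ι) {G : EuclideanSpace ℝ ι → ℝ} (hG : MemLp G 2 volume)
    (hle : ∀ ξ, ‖ξ‖ ^ m * ‖q ξ‖ ≤ G ξ) :
    ∫⁻ x, ENNReal.ofReal (ipderiv α (fun y => (𝓕 q y).re) x ^ 2) ≤
      ENNReal.ofReal ((2 * π) ^ (2 * m)) * ∫⁻ ξ, ‖G ξ‖ₑ ^ 2 := by
  rw [ipderiv_re_fourier_eq_of_moments hqm hmom α]
  have hgm : AEStronglyMeasurable (fun ξ => dsym α ξ * q ξ) volume :=
    (continuous_dsym _).aestronglyMeasurable.mul hqm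
  have hg : Integrable (fun ξ => dsym α ξ * q ξ) volume := by
    have := integrable_pow_mul_norm_dsym_mul hmom hqm α 0
    simp only [pow_zero, one_mul] at this
    exact (integrable_norm_iff hgm).1 this
  have hg2 := memLp_two_dsym_mul_of_env hqm α hG hle
  calc ∫⁻ x, ENNReal.ofReal ((𝓕 (fun ξ => dsym α ξ * q ξ) x).re ^ 2)
      ≤ ∫⁻ x, ‖𝓕 (fun ξ => dsym α ξ * q ξ) x‖ₑ ^ 2 := lintegral_mono fun x => ofReal_re_sq_le _
    _ = ∫⁻ ξ, ‖dsym α ξ * q ξ‖ₑ ^ 2 := lintegral_sq_fourier_eq hg hg2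
    _ ≤ ∫⁻ ξ, ENNReal.ofReal ((2 * π) ^ (2 * m)) * ‖G ξ‖ₑ ^ 2 := by
        refine lintegral_mono fun ξ => ?_
        have hG0 : 0 ≤ G ξ := le_trans (by positivity) (hle ξ)
        have h1 : ‖dsym α ξ * q ξ‖ ≤ (2 * π) ^ m * G ξ := by
          rw [norm_mul]
          calc ‖dsym α ξ‖ * ‖q ξ‖ ≤ (2 * π * ‖ξ‖) ^ m * ‖q ξ‖ :=
                mul_le_mul_of_nonneg_right (norm_dsym_le α ξ) (norm_nonneg _)
            _ = (2 * π) ^ m * (‖ξ‖ ^ m * ‖q ξ‖) := by rw [mul_pow]; ring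
            _ ≤ (2 * π) ^ m * G ξ := mul_le_mul_of_nonneg_left (hle ξ) (by positivity)
        have h2 : ‖dsym α ξ * q ξ‖ₑ ≤ ENNReal.ofReal ((2 * π) ^ m * G ξ) := by
          rw [← ofReal_norm]
          exact ENNReal.ofReal_le_ofReal h1
        calc ‖dsym α ξ * q ξ‖ₑ ^ 2 ≤ ENNReal.ofReal ((2 * π) ^ m * G ξ) ^ 2 := pow_le_pow_left' h2 2
          _ = ENNReal.ofReal ((2 * π) ^ (2 * m)) * ‖G ξ‖ₑ ^ 2 := by
              rw [ENNReal.ofReal_mul (by positivity), mul_pow, ← ENNReal.ofReal_pow (by positivity),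
                ← pow_mul, Real.enorm_eq_ofReal hG0, mul_comm m 2]
    _ = ENNReal.ofReal ((2 * π) ^ (2 * m)) * ∫⁻ ξ, ‖G ξ‖ₑ ^ 2 :=
        lintegral_const_mul' _ _ ENNReal.ofReal_ne_top

/-- **All coordinate tensors of a scalar synthesis are square integrable under moment
hypotheses**: `∫ |∇ᵐ Re 𝓕 q|² ≤ card(Fin m → ι) (2π)^{2m} ∫ G²`. [cite: Leray1934, §19] -/
theorem lintegral_dnormSq_re_fourier_le_of_env (hqm : AEStronglyMeasurable q volume)
    (hmom : ∀ k : ℕ, Integrable (fun ξ : EuclideanSpace ℝ ι => ‖ξ‖ ^ k * ‖q ξ‖) volume)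
    (m : ℕ) {G : EuclideanSpace ℝ ι → ℝ} (hG : MemLp G 2 volume)
    (hle : ∀ ξ, ‖ξ‖ ^ m * ‖q ξ‖ ≤ G ξ) :
    ∫⁻ x, ENNReal.ofReal (dnormSq m (fun y => (𝓕 q y).re) x) ≤
      Fintype.card (Fin m → ι) * (ENNReal.ofReal ((2 * π) ^ (2 * m)) * ∫⁻ ξ, ‖G ξ‖ₑ ^ 2) := by
  have hsm := contDiff_re_fourier_of_moments hmom
  have hmeas : ∀ α : Fin m → ι,
      Measurable fun x => ENNReal.ofReal (ipderiv α (fun y => (𝓕 q y).re) x ^ 2) := fun α =>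
    ((contDiff_ipderiv hsm α).continuous.pow 2).measurable.ennreal_ofReal
  calc ∫⁻ x, ENNReal.ofReal (dnormSq m (fun y => (𝓕 q y).re) x)
      = ∫⁻ x, ∑ α : Fin m → ι, ENNReal.ofReal (ipderiv α (fun y => (𝓕 q y).re) x ^ 2) := by
        refine lintegral_congr fun x => ?_
        unfold dnormSq
        exact ENNReal.ofReal_sum_of_nonneg fun α _ => sq_nonneg _
    _ = ∑ α : Fin m → ι, ∫⁻ x, ENNReal.ofReal (ipderiv α (fun y => (𝓕 q y).re) x ^ 2) :=
        lintegral_finsetSum _ fun α _ => hmeas α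
    _ ≤ ∑ _α : Fin m → ι, ENNReal.ofReal ((2 * π) ^ (2 * m)) * ∫⁻ ξ, ‖G ξ‖ₑ ^ 2 :=
        Finset.sum_le_sum fun α _ => lintegral_ipderiv_re_fourier_sq_le_of_env hqm hmom α hG hle
    _ = _ := by rw [Finset.sum_const, Finset.card_univ, nsmul_eq_mul]

/-- **Sobolev bound of a scalar synthesis under moment hypotheses**:
`∫ ‖Dᵐ Re 𝓕 q‖² ≤ (card ι)^m card(Fin m → ι) (2π)^{2m} ∫ G²` for a measurable symbol `q` with
integrable moments of every order and an `L²` envelope `‖ξ‖ᵐ ‖q ξ‖ ≤ G ξ` (the Fourier-side form of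
"`u ∈ L^∞_t H^k_x`", Tao 2011, Thm. 5.4 (iv)). [cite: Tao2011, Thm. 5.4 (iv)] -/
theorem lintegral_sq_norm_iteratedFDeriv_re_fourier_le_of_env (hqm : AEStronglyMeasurable q volume)
    (hmom : ∀ k : ℕ, Integrable (fun ξ : EuclideanSpace ℝ ι => ‖ξ‖ ^ k * ‖q ξ‖) volume)
    (m : ℕ) {G : EuclideanSpace ℝ ι → ℝ} (hG : MemLp G 2 volume)
    (hle : ∀ ξ, ‖ξ‖ ^ m * ‖q ξ‖ ≤ G ξ) :
    ∫⁻ x, ‖iteratedFDeriv ℝ m (fun y => (𝓕 q y).re) x‖ₑ ^ 2 ≤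
      ENNReal.ofReal ((Fintype.card ι : ℝ) ^ m) * (Fintype.card (Fin m → ι) *
        (ENNReal.ofReal ((2 * π) ^ (2 * m)) * ∫⁻ ξ, ‖G ξ‖ₑ ^ 2)) := by
  have hsm := contDiff_re_fourier_of_moments hmom
  calc ∫⁻ x, ‖iteratedFDeriv ℝ m (fun y => (𝓕 q y).re) x‖ₑ ^ 2
      ≤ ∫⁻ x, ENNReal.ofReal ((Fintype.card ι : ℝ) ^ m * dnormSq m (fun y => (𝓕 q y).re) x) := by
        refine lintegral_mono fun x => ?_
        rw [← ofReal_norm, ← ENNReal.ofReal_pow (norm_nonneg _)]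
        exact ENNReal.ofReal_le_ofReal (sq_norm_iteratedFDeriv_le_card_pow_mul_dnormSq hsm m x)
    _ = ENNReal.ofReal ((Fintype.card ι : ℝ) ^ m) *
          ∫⁻ x, ENNReal.ofReal (dnormSq m (fun y => (𝓕 q y).re) x) := by
        rw [← lintegral_const_mul' _ _ ENNReal.ofReal_ne_top]
        refine lintegral_congr fun x => ?_
        rw [ENNReal.ofReal_mul (by positivity)]
    _ ≤ _ := mul_le_mul_right (lintegral_dnormSq_re_fourier_le_of_env hqm hmom m hG hle) _

end ScalarMoments

/-! ## §5b The force pressure on `ℝ³`: gradient identity and Sobolev bounds -/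

section ForcePressureR3

variable {g : EuclideanSpace ℝ (Fin 3) → Fin 3 → ℂ} {K : ℕ} {B : ℝ}

/-- Components of a decaying force on `ℝ³` are integrable (`K ≥ 4`). [cite: LemarieRieusset2016, §6.1] -/
private theorem integrable_rawForce_apply (hg : HasDecay K B g) (hK : 4 ≤ K)
    (hgm : ∀ k, AEStronglyMeasurable (fun ξ => g ξ k) volume) (l : Fin 3) :
    Integrable (fun ξ => g ξ l) volume :=
  (hg.apply l).integrable (finrank_lt_of_card_lt (by rw [Fintype.card_fin]; omega)) (hgm l)

/-- Components of the Leray part of a decaying force on `ℝ³` are integrable (`K ≥ 4`). [cite: LemarieRieusset2016, §6.1] -/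
private theorem integrable_lerayPart_rawForce_apply (hg : HasDecay K B g) (hK : 4 ≤ K)
    (hgm : ∀ k, AEStronglyMeasurable (fun ξ => g ξ k) volume) (l : Fin 3) :
    Integrable (fun ξ => lerayPart g ξ l) volume :=
  ((hasDecay_lerayPart hg).apply l).integrable
    (finrank_lt_of_card_lt (by rw [Fintype.card_fin]; omega)) (aestronglyMeasurable_lerayPart_apply hgm l)

/-- **`∇ Δ⁻¹∇·f = f − P f`**: the gradient of the force pressure
`p_f = Re 𝓕 forcePresSymbol g` is `synthVel g − synthVel (lerayPart g)`, componentwise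
(the derivative under the Fourier integral, legitimate by the `L¹` bounds of §3, and the letter
identity of §2). [cite: Tao2011, (8) p. 3] -/
theorem gradient_forcePressure_apply (hg : HasDecay (1 + K) B g) (hK : 5 ≤ K)
    (hgm : ∀ k, AEStronglyMeasurable (fun ξ => g ξ k) volume) (x : EuclideanSpace ℝ (Fin 3))
    (l : Fin 3) :
    gradient (fun y => (𝓕 (forcePresSymbol g) y).re) x l =
      synthVel g x l - synthVel (lerayPart g) x l := by
  set q := forcePresSymbol g with hq
  have hg' : HasDecay K B g := hg.of_le (by omega)
  have hqi : Integrable q volume := integrable_forcePresSymbol hg' hK hgm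
  have hq1 : Integrable (fun ξ => ‖ξ‖ * ‖q ξ‖) volume :=
    integrable_norm_mul_norm_forcePresSymbol hg hK hgm
  have hdiff : Differentiable ℝ (𝓕 q) := Real.differentiable_fourier hqi hq1
  have h1 : gradient (fun y => (𝓕 q y).re) x l =
      fderiv ℝ (fun y => (𝓕 q y).re) x (EuclideanSpace.single l (1 : ℝ)) := by
    have : gradient (fun y => (𝓕 q y).re) x l =
        ⟪gradient (fun y => (𝓕 q y).re) x, EuclideanSpace.single l (1 : ℝ)⟫ := by
      rw [EuclideanSpace.inner_single_right]; simp
    rw [this, gradient, InnerProductSpace.toDual_symm_apply]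
  have h2 : HasFDerivAt (fun y => (𝓕 q y).re) (Complex.reCLM.comp (fderiv ℝ (𝓕 q) x)) x :=
    Complex.reCLM.hasFDerivAt.comp x (hdiff x).hasFDerivAt
  rw [h1, h2.fderiv, ContinuousLinearMap.comp_apply, Complex.reCLM_apply,
    fderiv_fourier_apply_of_integrable hqi hq1, synthVel_apply, synthVel_apply, ← Complex.sub_re,
    ← fourier_sub' (integrable_rawForce_apply hg' (by omega) hgm l)
      (integrable_lerayPart_rawForce_apply hg' (by omega) hgm l)]
  congr 1
  refine congrFun (fourier_congr' fun ξ => ?_) x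
  rw [Pi.sub_apply, ← letter_mul_forcePresSymbol g ξ l, hq, EuclideanSpace.inner_single_right]
  simp

/-- Vector form of `gradient_forcePressure_apply`: `∇p_f(x) = synthVel g x − synthVel (P g) x`. [cite: Tao2011, (8) p. 3] -/
theorem gradient_forcePressure (hg : HasDecay (1 + K) B g) (hK : 5 ≤ K)
    (hgm : ∀ k, AEStronglyMeasurable (fun ξ => g ξ k) volume) (x : EuclideanSpace ℝ (Fin 3)) :
    gradient (fun y => (𝓕 (forcePresSymbol g) y).re) x = synthVel g x - synthVel (lerayPart g) x := by
  ext l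
  rw [PiLp.sub_apply]
  exact gradient_forcePressure_apply hg hK hgm x l

/-- **The force pressure on `ℝ³` is smooth in space** (every moment of its symbol is integrable). [cite: Tao2011, Thm. 5.4 (iv) with (8)] -/
theorem contDiff_forcePressure (hdec : ∀ K : ℕ, ∃ B, HasDecay K B g)
    (hgm : ∀ k, AEStronglyMeasurable (fun ξ => g ξ k) volume) :
    ContDiff ℝ ∞ fun y => (𝓕 (forcePresSymbol g) y).re := by
  refine contDiff_re_fourier_of_moments fun k => ?_
  obtain ⟨B, hB⟩ := hdec (k + 5)
  exact integrable_pow_mul_norm_forcePresSymbol hB le_rfl hgm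

/-- **Sobolev bounds of the force pressure on `ℝ³`, every order `n ≥ 0`** (Tao 2011, Thm. 5.4
(iv): the normalised pressure, which carries `Δ⁻¹∇·f`, lies in `L^∞_t H^k_x` for all `k ≥ 0`):
`∫ ‖Dⁿ Re 𝓕 forcePresSymbol g‖² ≤ 3ⁿ · 3ⁿ · (2π)^{2n} · (3B/2π)² · ∫ (‖ξ‖⁻¹(1+‖ξ‖)⁻³)²` for a force
with decay of order `n + 3` (constant `B`) and of every order (qualitatively). The `n = 0` case is
the `L²` bound of `Δ⁻¹∇·f`, finite because `‖ξ‖⁻¹ ∈ L²_loc(ℝ³)`. [cite: Tao2011, Thm. 5.4 (iv) with (8)] -/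
theorem lintegral_sq_norm_iteratedFDeriv_forcePressure_le (n : ℕ) (hg : HasDecay (n + 3) B g)
    (hdec : ∀ K : ℕ, ∃ B, HasDecay K B g)
    (hgm : ∀ k, AEStronglyMeasurable (fun ξ => g ξ k) volume) :
    ∫⁻ x, ‖iteratedFDeriv ℝ n (fun y => (𝓕 (forcePresSymbol g) y).re) x‖ₑ ^ 2 ≤
      ENNReal.ofReal ((3 : ℝ) ^ n) * (Fintype.card (Fin n → Fin 3) *
        (ENNReal.ofReal ((2 * π) ^ (2 * n)) *
          ∫⁻ ξ : EuclideanSpace ℝ (Fin 3),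
            ‖Fintype.card (Fin 3) * B / (2 * π) * (‖ξ‖⁻¹ * ((1 + ‖ξ‖) ^ 3)⁻¹)‖ₑ ^ 2)) := by
  have hmom : ∀ k : ℕ, Integrable
      (fun ξ : EuclideanSpace ℝ (Fin 3) => ‖ξ‖ ^ k * ‖forcePresSymbol g ξ‖) volume := fun k => by
    obtain ⟨B', hB'⟩ := hdec (k + 5)
    exact integrable_pow_mul_norm_forcePresSymbol hB' le_rfl hgm
  have h := lintegral_sq_norm_iteratedFDeriv_re_fourier_le_of_env
    (aestronglyMeasurable_forcePresSymbol hgm) hmom n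
    (memLp_two_const_mul_singularWeight (K := 3) le_rfl (Fintype.card (Fin 3) * B / (2 * π)))
    (fun ξ => pow_mul_norm_forcePresSymbol_le hg ξ)
  simpa only [Fintype.card_fin, Nat.cast_ofNat] using h

/-- The singular-weight mass `∫ (c ‖ξ‖⁻¹ (1+‖ξ‖)⁻³)² dξ` on `ℝ³` is finite. [cite: BahouriCheminDanchin2011, Prop. 1.34 (proof)] -/
theorem lintegral_singularWeight_sq_lt_top (c : ℝ) :
    ∫⁻ ξ : EuclideanSpace ℝ (Fin 3), ‖c * (‖ξ‖⁻¹ * ((1 + ‖ξ‖) ^ 3)⁻¹)‖ₑ ^ 2 < ⊤ :=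
  lintegral_enorm_sq_lt_top_of_memLp (memLp_two_const_mul_singularWeight le_rfl c)

/-- **Uniform-in-time Sobolev bounds of the force pressure of a force tower on `ℝ³`**: if the raw
force has, at level `0`, decay of every order UNIFORMLY on `[0, T]` (the `IsFourierFamily` shape,
or `ForcedFourierForceData`'s `hasDecay_forceData_uniform`), then for every `n` there is
`C < ∞` with `∫ ‖Dⁿ p_f(t)‖² ≤ C` for all `t ∈ [0, T]` — Tao's "`p ∈ L^∞_t H^k_x`, `k ≥ 0`" for
the force term of the normalised pressure. [cite: Tao2011, Thm. 5.4 (iv) with (8)] -/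
theorem sobolev_forcePressure {T : ℝ} {g : ℝ → EuclideanSpace ℝ (Fin 3) → Fin 3 → ℂ}
    (hdec : ∀ K : ℕ, ∃ B, ∀ t ∈ Icc 0 T, HasDecay K B (g t))
    (hgm : ∀ t ∈ Icc 0 T, ∀ k, AEStronglyMeasurable (fun ξ => g t ξ k) volume) (n : ℕ) :
    ∃ C : ℝ≥0, ∀ t ∈ Icc 0 T,
      ∫⁻ x, ‖iteratedFDeriv ℝ n (fun y => (𝓕 (forcePresSymbol (g t)) y).re) x‖ₑ ^ 2 ≤ C := by
  obtain ⟨B, hB⟩ := hdec (n + 3)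
  set M : ℝ≥0∞ := ENNReal.ofReal ((3 : ℝ) ^ n) * (Fintype.card (Fin n → Fin 3) *
    (ENNReal.ofReal ((2 * π) ^ (2 * n)) *
      ∫⁻ ξ : EuclideanSpace ℝ (Fin 3),
        ‖Fintype.card (Fin 3) * B / (2 * π) * (‖ξ‖⁻¹ * ((1 + ‖ξ‖) ^ 3)⁻¹)‖ₑ ^ 2)) with hM
  have hMtop : M ≠ ⊤ := by
    refine ENNReal.mul_ne_top ENNReal.ofReal_ne_top (ENNReal.mul_ne_top (ENNReal.natCast_ne_top _)
      (ENNReal.mul_ne_top ENNReal.ofReal_ne_top (lintegral_singularWeight_sq_lt_top _).ne))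
  refine ⟨M.toNNReal, fun t ht => ?_⟩
  rw [ENNReal.coe_toNNReal hMtop]
  exact lintegral_sq_norm_iteratedFDeriv_forcePressure_le n (hB t ht) (fun K => by
    obtain ⟨B', hB'⟩ := hdec K; exact ⟨B', hB' t ht⟩) (hgm t ht)

end ForcePressureR3

end FourierNS

/-! ## §6 Re-gauging a classical solution by a gradient force -/

section Regauge

open FourierNS

variable {E : Type*} [NormedAddCommGroup E] [InnerProductSpace ℝ E] [FiniteDimensional ℝ E]
  [MeasurableSpace E] [BorelSpace E]

omit [MeasurableSpace E] [BorelSpace E] in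
/-- **Re-gauging**: a classical solution of the Navier–Stokes system with force `f₁` and pressure
`p₁` on a time set `S` is a classical solution with force `f₂` and pressure `p₁ + p₂` as soon as
`p₂` is jointly smooth on `S × E` and `∇p₂(t) = f₂(t) − f₁(t)` there (the momentum equation only
sees `-∇p + f`; Tao 2011, (8): the gradient part of the force is carried by the normalised
pressure). [cite: Tao2011, (8) p. 3] -/
theorem IsClassicalNSSolutionOn.add_gradient {S : Set ℝ} {ν : ℝ} {f₁ f₂ u : ℝ → E → E}
    {p₁ p₂ : ℝ → E → ℝ} (h : IsClassicalNSSolutionOn S ν f₁ u p₁) (hp₂ : IsSmoothSpaceTimeOn S p₂)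
    (hgrad : ∀ t ∈ S, ∀ x, gradient (p₂ t) x = f₂ t x - f₁ t x) :
    IsClassicalNSSolutionOn S ν f₂ u (fun t x => p₁ t x + p₂ t x) where
  smooth_velocity := h.smooth_velocity
  smooth_pressure := h.smooth_pressure.add hp₂
  momentum t ht x := by
    have hd1 : DifferentiableAt ℝ (p₁ t) x :=
      ((h.smooth_pressure.contDiff_slice ht).differentiable (by simp)).differentiableAt
    have hd2 : DifferentiableAt ℝ (p₂ t) x :=
      ((hp₂.contDiff_slice ht).differentiable (by simp)).differentiableAt
    have hsum : gradient (fun y => p₁ t y + p₂ t y) x = gradient (p₁ t) x + gradient (p₂ t) x := by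
      rw [gradient, gradient, gradient, ← map_add, ← fderiv_add hd1 hd2]
      rfl
    rw [hsum, hgrad t ht x, h.momentum t ht x]
    abel
  divFree := h.divFree

omit [MeasurableSpace E] [BorelSpace E] in
/-- Replacing the force by one that agrees with it on the time set (the momentum equation is an
identity on `S × E` only). [cite: Tao2011, (8) p. 3] -/
theorem IsClassicalNSSolutionOn.copy_force {S : Set ℝ} {ν : ℝ} {f₁ f₂ u : ℝ → E → E}
    {p : ℝ → E → ℝ} (h : IsClassicalNSSolutionOn S ν f₁ u p)
    (hf : ∀ t ∈ S, ∀ x, f₁ t x = f₂ t x) : IsClassicalNSSolutionOn S ν f₂ u p where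
  smooth_velocity := h.smooth_velocity
  smooth_pressure := h.smooth_pressure
  momentum t ht x := by rw [← hf t ht x]; exact h.momentum t ht x
  divFree := h.divFree

/-- Sobolev bounds of a re-gauged pressure: `∫ ‖Dⁿ(p₁ + p₂)‖² ≤ 2 ∫ ‖Dⁿp₁‖² + 2 ∫ ‖Dⁿp₂‖²` for
smooth `p₁`, `p₂`. [folklore] -/
private theorem lintegral_sq_norm_iteratedFDeriv_add_le {p₁ p₂ : E → ℝ} (h₁ : ContDiff ℝ ∞ p₁)
    (h₂ : ContDiff ℝ ∞ p₂) (n : ℕ) :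
    ∫⁻ x, ‖iteratedFDeriv ℝ n (p₁ + p₂) x‖ₑ ^ 2 ≤
      (2 * ∫⁻ x, ‖iteratedFDeriv ℝ n p₁ x‖ₑ ^ 2) + 2 * ∫⁻ x, ‖iteratedFDeriv ℝ n p₂ x‖ₑ ^ 2 := by
  have h₁n : ContDiff ℝ n p₁ := contDiff_infty.1 h₁ n
  have h₂n : ContDiff ℝ n p₂ := contDiff_infty.1 h₂ n
  have hmeas : AEMeasurable (fun x => ‖iteratedFDeriv ℝ n p₁ x‖ₑ ^ 2) volume :=
    ((h₁n.continuous_iteratedFDeriv (m := n) le_rfl).enorm.measurable.pow_const 2).aemeasurable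
  calc ∫⁻ x, ‖iteratedFDeriv ℝ n (p₁ + p₂) x‖ₑ ^ 2
      ≤ ∫⁻ x, (2 * ‖iteratedFDeriv ℝ n p₁ x‖ₑ ^ 2 + 2 * ‖iteratedFDeriv ℝ n p₂ x‖ₑ ^ 2) := by
        refine lintegral_mono fun x => ?_
        rw [iteratedFDeriv_add_apply h₁n.contDiffAt h₂n.contDiffAt]
        set A := iteratedFDeriv ℝ n p₁ x
        set B := iteratedFDeriv ℝ n p₂ x
        have hreal : ‖A + B‖ ^ 2 ≤ 2 * ‖A‖ ^ 2 + 2 * ‖B‖ ^ 2 := by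
          nlinarith [norm_add_le A B, sq_nonneg (‖A‖ - ‖B‖), norm_nonneg (A + B), norm_nonneg A,
            norm_nonneg B]
        calc ‖A + B‖ₑ ^ 2 = ENNReal.ofReal (‖A + B‖ ^ 2) := by
              rw [← ofReal_norm, ENNReal.ofReal_pow (norm_nonneg _)]
          _ ≤ ENNReal.ofReal (2 * ‖A‖ ^ 2 + 2 * ‖B‖ ^ 2) := ENNReal.ofReal_le_ofReal hreal
          _ = 2 * ‖A‖ₑ ^ 2 + 2 * ‖B‖ₑ ^ 2 := by
              rw [ENNReal.ofReal_add (by positivity) (by positivity), ENNReal.ofReal_mul zero_le_two,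
                ENNReal.ofReal_mul zero_le_two, ENNReal.ofReal_pow (norm_nonneg _),
                ENNReal.ofReal_pow (norm_nonneg _), ofReal_norm, ofReal_norm, ENNReal.ofReal_ofNat]
    _ = (2 * ∫⁻ x, ‖iteratedFDeriv ℝ n p₁ x‖ₑ ^ 2) + 2 * ∫⁻ x, ‖iteratedFDeriv ℝ n p₂ x‖ₑ ^ 2 := by
        rw [lintegral_add_left' (hmeas.const_mul _), lintegral_const_mul' _ _ (by simp),
          lintegral_const_mul' _ _ (by simp)]

end Regauge

/-! ## §6b The adapter: from a PROJECTED-force classical solution to the RAW force -/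

section Adapter

open FourierNS

/-- **From the projected force to the raw force.** Let `g : ℝ → (ℝ³ → ℂ³)` be a raw Fourier force
with pointwise-decaying time-derivative towers of every order on `[0, T]` (`T > 0`), and let
`(u, p)` be a classical solution on `[0, T]` of the Navier–Stokes system driven by the PROJECTED
force `synthVel (lerayPart (g t))` (the conclusion of the classical half of the forced engine).
Then `(u, p + p_f)`, `p_f(t) = Re 𝓕 forcePresSymbol (g t)` (Tao's `Δ⁻¹∇·f`), is a classical
solution driven by the RAW force `synthVel (g t)` (`= f t` for `g = forceData`,
`ForcedFourierForceData.synthVel_forceData_of_mem`). [cite: Tao2011, Thm. 5.4 (iv) with (8)] -/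
theorem IsClassicalNSSolutionOn.of_lerayPart_force {T ν : ℝ} (hT : 0 < T)
    {g : ℝ → EuclideanSpace ℝ (Fin 3) → Fin 3 → ℂ}
    (hall : ∀ n : ℕ, ∃ G : ℕ → ℝ → EuclideanSpace ℝ (Fin 3) → Fin 3 → ℂ, G 0 = g ∧
      ∀ l, IsFourierFamily T n (fun k t ξ => G k t ξ l))
    {u : ℝ → EuclideanSpace ℝ (Fin 3) → EuclideanSpace ℝ (Fin 3)}
    {p : ℝ → EuclideanSpace ℝ (Fin 3) → ℝ}
    (h : IsClassicalNSSolutionOn (Icc 0 T) ν (fun t => synthVel (lerayPart (g t))) u p) :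
    IsClassicalNSSolutionOn (Icc 0 T) ν (fun t => synthVel (g t)) u
      (fun t x => p t x + (𝓕 (forcePresSymbol (g t)) x).re) := by
  refine h.add_gradient (isSmoothSpaceTimeOn_forcePressure hT hall) fun t ht x => ?_
  obtain ⟨G, hG0, hG⟩ := hall 0
  classical
  choose C hC using fun l => (hG l).decay 0 le_rfl 6
  have hdec : HasDecay (1 + 5) (∑ l, C l) (g t) := by
    refine HasDecay.of_apply (Finset.sum_nonneg fun l _ => (hC l t ht).nonneg) fun l => ?_
    have h1 : HasDecay 6 (C l) (fun ξ => g t ξ l) := by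
      have := hC l t ht; rwa [hG0] at this
    exact h1.mono (Finset.single_le_sum (fun l _ => (hC l t ht).nonneg) (Finset.mem_univ l))
  have hgm : ∀ k, AEStronglyMeasurable (fun ξ => g t ξ k) volume := fun k => by
    have := (hG k).meas 0 le_rfl t ht; rwa [hG0] at this
  show gradient (fun y => (𝓕 (forcePresSymbol (g t)) y).re) x =
    synthVel (g t) x - synthVel (lerayPart (g t)) x
  exact gradient_forcePressure hdec le_rfl hgm x

/-- **Pressure Sobolev bounds survive the adapter**: if `p(t) ∈ H^k` uniformly on `[0, T]` for all
`k` then so does `p + p_f`. [cite: Tao2011, Thm. 5.4 (iv) with (8)] -/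
theorem sobolev_pressure_add_forcePressure {T : ℝ}
    {g : ℝ → EuclideanSpace ℝ (Fin 3) → Fin 3 → ℂ}
    (hall : ∀ n : ℕ, ∃ G : ℕ → ℝ → EuclideanSpace ℝ (Fin 3) → Fin 3 → ℂ, G 0 = g ∧
      ∀ l, IsFourierFamily T n (fun k t ξ => G k t ξ l))
    {p : ℝ → EuclideanSpace ℝ (Fin 3) → ℝ} (hp : IsSmoothSpaceTimeOn (Icc 0 T) p)
    (hpS : ∀ n : ℕ, ∃ C : ℝ≥0, ∀ t ∈ Icc 0 T, ∫⁻ x, ‖iteratedFDeriv ℝ n (p t) x‖ₑ ^ 2 ≤ C) (n : ℕ) :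
    ∃ C : ℝ≥0, ∀ t ∈ Icc 0 T,
      ∫⁻ x, ‖iteratedFDeriv ℝ n (fun y => p t y + (𝓕 (forcePresSymbol (g t)) y).re) x‖ₑ ^ 2 ≤ C := by
  obtain ⟨G, hG0, hG⟩ := hall 0
  classical
  have hdec : ∀ K : ℕ, ∃ B, ∀ t ∈ Icc 0 T, HasDecay K B (g t) := fun K => by
    choose C hC using fun l => (hG l).decay 0 le_rfl K
    refine ⟨∑ l, C l, fun t ht => HasDecay.of_apply
      (Finset.sum_nonneg fun l _ => (hC l t ht).nonneg) fun l => ?_⟩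
    have h1 : HasDecay K (C l) (fun ξ => g t ξ l) := by
      have := hC l t ht; rwa [hG0] at this
    exact h1.mono (Finset.single_le_sum (fun l _ => (hC l t ht).nonneg) (Finset.mem_univ l))
  have hgm : ∀ t ∈ Icc 0 T, ∀ k, AEStronglyMeasurable (fun ξ => g t ξ k) volume := fun t ht k => by
    have := (hG k).meas 0 le_rfl t ht; rwa [hG0] at this
  obtain ⟨C₁, hC₁⟩ := hpS n
  obtain ⟨C₂, hC₂⟩ := sobolev_forcePressure hdec hgm n
  refine ⟨2 * C₁ + 2 * C₂, fun t ht => ?_⟩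
  have h1 : ContDiff ℝ ∞ (p t) := hp.contDiff_slice ht
  have h2 : ContDiff ℝ ∞ fun y => (𝓕 (forcePresSymbol (g t)) y).re :=
    contDiff_forcePressure (fun K => by obtain ⟨B, hB⟩ := hdec K; exact ⟨B, hB t ht⟩) (hgm t ht)
  have heq : (fun y => p t y + (𝓕 (forcePresSymbol (g t)) y).re) =
      p t + fun y => (𝓕 (forcePresSymbol (g t)) y).re := rfl
  rw [heq]
  calc ∫⁻ x, ‖iteratedFDeriv ℝ n (p t + fun y => (𝓕 (forcePresSymbol (g t)) y).re) x‖ₑ ^ 2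
      ≤ (2 * ∫⁻ x, ‖iteratedFDeriv ℝ n (p t) x‖ₑ ^ 2) +
        2 * ∫⁻ x, ‖iteratedFDeriv ℝ n (fun y => (𝓕 (forcePresSymbol (g t)) y).re) x‖ₑ ^ 2 :=
        lintegral_sq_norm_iteratedFDeriv_add_le h1 h2 n
    _ ≤ 2 * (C₁ : ℝ≥0∞) + 2 * (C₂ : ℝ≥0∞) := by
        gcongr
        · exact hC₁ t ht
        · exact hC₂ t ht
    _ = ((2 * C₁ + 2 * C₂ : ℝ≥0) : ℝ≥0∞) := by push_cast; ring

end Adapter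

end Literature.Analysis.FluidPDE

end
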